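import Mathlib
import Literature.Probability.Percolation.PositiveAssociation
import Literature.Probability.LatticeModels.SahiThirdOrderCorrelation

/-!
# `NoHeavyLowerTail` (stmt-CriticalPhenomena-4575) — barrier: positive association does NOT imply Sahi's `C₃`

Support file of the `|A| = 5` / master-family surge, seat `prim-l12-p5`, `--supports stmt-CriticalPhenomena-4575`.
Everything PROVED; no definitions, no named facts.

For up-sets `A, B, C` of a finite distributive lattice with an FKG measure `μ`, Sahi's `E₃(1_A,1_B,1_C)` depends only on the
joint law `ν` of `(1_A,1_B,1_C) ∈ {0,1}³`, and `ν` — a monotone image of `μ` — is positively associated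
(`Literature.Probability.Percolation.IsPositivelyAssociated.map`).  So one might hope to prove `C₃` (tree:
`Summit…Theorems.SahiConjecture 3`, `KahnConjecture`) from positive association of `ν` alone, i.e. from the totality of
Harris-type inequalities between increasing events measurable w.r.t. `A, B, C`.  THIS FILE REFUTES THAT HOPE:

* `exists_isPositivelyAssociated_sahiE3_neg` — there is a positively associated probability measure `ν` on the cube
  `Bool × Bool × Bool` (coordinatewise order) under which the three coordinate events `{x₁ = true}`, `{x₂ = true}`,
  `{x₃ = true}` (increasing) have `sahiE3 ν A₁ A₂ A₃ < 0`; explicitly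
  `ν = ¼δ₀₀₀ + ⅙(δ₁₁₀ + δ₁₀₁ + δ₀₁₁) + ¼δ₁₁₁` and `E₃ = 2·¼ + (7/12)³ − 3·(7/12)(5/12) = −53/1728`.

`ν` violates the FKG lattice condition (`ν(111)ν(100) = 0 < ν(110)ν(101)`), consistently with Sahi's theorem for principal
up-sets; if `C₃` holds, `ν` is not the pattern law of any up-set triple under any FKG measure.  Association is checked
on all
pairs of upper sets: an upper set `U ∌ 000` with `111 ∈ U` has `ν(U) = ¼ + d_U/6`, `d_U` = number of two-`true` points
in `U`,
and `d_{U∩V} ≥ d_U + d_V − 3`; the tightest case is `(d_U, d_V) = (1,2)`: `¼ ≥ 35/144`.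
Seat report: run/shared/lean/prim/prim-l12/prim-l12-p5/P5-REPORT.md §2 (two independent exact implementations agree).
-/

noncomputable section

namespace Summit.CriticalPhenomena.PercolationContinuityZ3.Theorems

namespace AssociationNoGo

open MeasureTheory Measure Set
open Literature.Probability.Percolation (IsPositivelyAssociated isPositivelyAssociated_of_real)
open Literature.Probability.LatticeModels (sahiE3)

/-- **Positive association does not imply `C₃`.**  There is a positively associated probability measure on the cube
`Bool × Bool × Bool` (coordinatewise order) for which the three increasing coordinate events have strictly negative Sahi
functional `E₃`: `ν = ¼δ₀₀₀ + ⅙(δ₁₁₀+δ₁₀₁+δ₀₁₁) + ¼δ₁₁₁`, `E₃ = −53/1728`.  Hence Sahi's `C₃` / Kahn's Conjecture 5 is not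
a consequence of the positive association of the joint law of the three events. [this file] -/
theorem exists_isPositivelyAssociated_sahiE3_neg :
    ∃ ν : Measure (Bool × Bool × Bool), IsProbabilityMeasure ν ∧ IsPositivelyAssociated ν ∧
      IsUpperSet {x : Bool × Bool × Bool | x.1 = true} ∧ IsUpperSet {x : Bool × Bool × Bool | x.2.1 = true} ∧
      IsUpperSet {x : Bool × Bool × Bool | x.2.2 = true} ∧
      sahiE3 ν {x : Bool × Bool × Bool | x.1 = true} {x : Bool × Bool × Bool | x.2.1 = true}
        {x : Bool × Bool × Bool | x.2.2 = true} < 0 := by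
  classical
  -- the five atoms
  let p000 : (Bool × Bool × Bool) := (false, false, false)
  let p110 : (Bool × Bool × Bool) := (true, true, false)
  let p101 : (Bool × Bool × Bool) := (true, false, true)
  let p011 : (Bool × Bool × Bool) := (false, true, true)
  let p111 : (Bool × Bool × Bool) := (true, true, true)
  let ν : Measure (Bool × Bool × Bool) :=
    ENNReal.ofReal (1/4) • dirac p000 + ENNReal.ofReal (1/6) • dirac p110 + ENNReal.ofReal (1/6) • dirac p101 +
      ENNReal.ofReal (1/6) • dirac p011 + ENNReal.ofReal (1/4) • dirac p111
  -- the real weight of a set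
  let w : Set (Bool × Bool × Bool) → ℝ := fun S =>
    (if p000 ∈ S then 1/4 else 0) + (if p110 ∈ S then 1/6 else 0) + (if p101 ∈ S then 1/6 else 0) +
      (if p011 ∈ S then 1/6 else 0) + (if p111 ∈ S then 1/4 else 0)
  have hw_nonneg : ∀ S, 0 ≤ w S := by
    intro S; simp only [w]; positivity
  have happ : ∀ S : Set (Bool × Bool × Bool), ν S = ENNReal.ofReal (w S) := by
    intro S
    have hS : MeasurableSet S := (Set.toFinite S).measurableSet
    simp only [ν, w, Measure.add_apply, Measure.smul_apply, smul_eq_mul, dirac_apply' _ hS, Set.indicator,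
      Pi.one_apply, mul_ite, mul_one, mul_zero]
    have e : ∀ (q : Prop) [Decidable q] (c : ℝ), 0 ≤ c →
        (if q then ENNReal.ofReal c else 0) = ENNReal.ofReal (if q then c else 0) := by
      intro q _ c _; split_ifs <;> simp
    rw [e _ (1/4) (by norm_num), e _ (1/6) (by norm_num), e _ (1/6) (by norm_num), e _ (1/6) (by norm_num),
      e _ (1/4) (by norm_num), ← ENNReal.ofReal_add, ← ENNReal.ofReal_add, ← ENNReal.ofReal_add, ← ENNReal.ofReal_add]
    all_goals positivity
  have hreal : ∀ S : Set (Bool × Bool × Bool), ν.real S = w S := by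
    intro S; rw [measureReal_def, happ, ENNReal.toReal_ofReal (hw_nonneg S)]
  have hprob : IsProbabilityMeasure ν := by
    refine ⟨?_⟩
    rw [happ]
    have : w Set.univ = 1 := by simp only [w, Set.mem_univ, if_true]; norm_num
    rw [this, ENNReal.ofReal_one]
  refine ⟨ν, hprob, ?_, ?_, ?_, ?_, ?_⟩
  · -- positive association: all pairs of upper sets
    refine isPositivelyAssociated_of_real fun A B hA hB _ _ => ?_
    rw [hreal, hreal, hreal]
    -- order facts
    have hbot : ∀ x : (Bool × Bool × Bool), p000 ≤ x := by decide
    have htop : ∀ x : (Bool × Bool × Bool), x ≤ p111 := by decide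
    by_cases hA0 : p000 ∈ A
    · -- A = univ
      have hAall : ∀ x, x ∈ A := fun x => hA (hbot x) hA0
      have h1 : w A = 1 := by simp only [w, hAall, if_true]; norm_num
      have h2 : w (A ∩ B) = w B := by simp only [w, Set.mem_inter_iff, hAall, true_and]
      rw [h1, h2, one_mul]
    by_cases hB0 : p000 ∈ B
    · have hBall : ∀ x, x ∈ B := fun x => hB (hbot x) hB0
      have h1 : w B = 1 := by simp only [w, hBall, if_true]; norm_num
      have h2 : w (A ∩ B) = w A := by simp only [w, Set.mem_inter_iff, hBall, and_true]
      rw [h1, h2, mul_one]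
    by_cases hA1 : p111 ∈ A
    swap
    · -- A = ∅ on the support
      have hAnone : ∀ x, x ∉ A := fun x hx => hA1 (hA (htop x) hx)
      have h1 : w A = 0 := by simp only [w, hAnone, if_false]; norm_num
      rw [h1, zero_mul]; exact hw_nonneg _
    by_cases hB1 : p111 ∈ B
    swap
    · have hBnone : ∀ x, x ∉ B := fun x hx => hB1 (hB (htop x) hx)
      have h1 : w B = 0 := by simp only [w, hBnone, if_false]; norm_num
      rw [h1, mul_zero]; exact hw_nonneg _
    -- main case: 000 ∉ A,B; 111 ∈ A,B; split on the doubletons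
    have hAB0 : p000 ∉ A ∩ B := fun h => hA0 h.1
    have hAB1 : p111 ∈ A ∩ B := ⟨hA1, hB1⟩
    simp only [w, hA0, hB0, hA1, hB1, hAB0, hAB1, if_true, if_false, Set.mem_inter_iff]
    by_cases a1 : p110 ∈ A <;> by_cases a2 : p101 ∈ A <;> by_cases a3 : p011 ∈ A <;>
      by_cases b1 : p110 ∈ B <;> by_cases b2 : p101 ∈ B <;> by_cases b3 : p011 ∈ B <;>
      simp only [a1, a2, a3, b1, b2, b3, if_true, if_false, and_true, and_self, and_false] <;>
      norm_num
  · intro x y hxy hx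
    simp only [Set.mem_setOf_eq] at hx ⊢
    have := hxy.1; rw [hx] at this; exact top_le_iff.mp this |>.symm ▸ rfl
  · intro x y hxy hx
    simp only [Set.mem_setOf_eq] at hx ⊢
    have := hxy.2.1; rw [hx] at this
    revert this; cases y.2.1 <;> simp
  · intro x y hxy hx
    simp only [Set.mem_setOf_eq] at hx ⊢
    have := hxy.2.2; rw [hx] at this
    revert this; cases y.2.2 <;> simp
  · -- the value of E₃
    simp only [sahiE3, hreal, w, p000, p110, p101, p011, p111, Set.mem_inter_iff, Set.mem_setOf_eq,
      Bool.false_eq_true, and_false, and_true, and_self, if_true, if_false]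
    norm_num

/-! ### Prior art: Kahn's observation with the Doyle–Fishburn–Shepp law (appended 2026-08-20)

PRIORITY / PRIOR ART.  The phenomenon "positive association does not imply Sahi's (4)" is IN PRINT: J. Kahn, *A note on
positive association* (arXiv:2210.08653, 2022), §1 after Conjecture 5, observes that the law `μ₃` of the fixed-point set of a
uniform permutation of `[3]` — positively associated by Doyle–Fishburn–Shepp [DoyleFishburnShepp1988] (`μ₃ = ⅓δ_∅ +
⅙(δ_{1}+δ_{2}+δ_{3}) + ⅙δ_{123}`) — with the increasing events `A_{ij} = {i or j is fixed}` has
`μ(A) = ½, μ(AB) = ⅓, μ(ABC) = ⅙`, so Sahi's cubic (4) equals `−1/24 < 0`; and he notes that a positive answer to his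
Question 1 ("are all PA measures UI?") even for `μ₃` would REFUTE Sahi's conjecture.  The theorem
`exists_isPositivelyAssociated_sahiE3_neg` above is a second, exchangeable 5-atom witness of the same phenomenon
(found independently by a 7-dimensional search; Lean-certified by enumeration); the theorem below certifies Kahn's own
witness the same way.  Neither law is a monotone image of a product measure if `C₃` holds (Kahn's Question 1 is exactly
the realizability question of the seat report, P5-REPORT §2(b)). -/

/-- **Kahn's witness (2022), Lean-certified**: the Doyle–Fishburn–Shepp law `μ₃ = ⅓δ₀₀₀ + ⅙(δ₁₀₀+δ₀₁₀+δ₀₀₁) + ⅙δ₁₁₁`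
on `Bool × Bool × Bool` is a positively associated probability measure, the events `A_{ij} = {xᵢ ∨ xⱼ}` are increasing,
and `sahiE3 μ₃ A₁₂ A₁₃ A₂₃ = 2·⅙ + (½)³ − 3·½·⅓ = −1/24`.  (Association is re-proved here by enumeration of the upper
sets; in print it is the `n = 3` case of the Doyle–Fishburn–Shepp theorem.)
[cite: Kahn2022, §1 (Corollary 4 and the discussion after Conjecture 5)]; [cite: DoyleFishburnShepp1988, Theorem 1] -/
theorem exists_isPositivelyAssociated_sahiE3_neg_kahn :
    ∃ ν : Measure (Bool × Bool × Bool), IsProbabilityMeasure ν ∧ IsPositivelyAssociated ν ∧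
      IsUpperSet {x : Bool × Bool × Bool | x.1 = true ∨ x.2.1 = true} ∧
      IsUpperSet {x : Bool × Bool × Bool | x.1 = true ∨ x.2.2 = true} ∧
      IsUpperSet {x : Bool × Bool × Bool | x.2.1 = true ∨ x.2.2 = true} ∧
      sahiE3 ν {x : Bool × Bool × Bool | x.1 = true ∨ x.2.1 = true} {x : Bool × Bool × Bool | x.1 = true ∨ x.2.2 = true}
        {x : Bool × Bool × Bool | x.2.1 = true ∨ x.2.2 = true} = -1/24 := by
  classical
  let p000 : (Bool × Bool × Bool) := (false, false, false)
  let p100 : (Bool × Bool × Bool) := (true, false, false)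
  let p010 : (Bool × Bool × Bool) := (false, true, false)
  let p001 : (Bool × Bool × Bool) := (false, false, true)
  let p111 : (Bool × Bool × Bool) := (true, true, true)
  let ν : Measure (Bool × Bool × Bool) :=
    ENNReal.ofReal (1/3) • dirac p000 + ENNReal.ofReal (1/6) • dirac p100 + ENNReal.ofReal (1/6) • dirac p010 +
      ENNReal.ofReal (1/6) • dirac p001 + ENNReal.ofReal (1/6) • dirac p111
  let w : Set (Bool × Bool × Bool) → ℝ := fun S =>
    (if p000 ∈ S then 1/3 else 0) + (if p100 ∈ S then 1/6 else 0) + (if p010 ∈ S then 1/6 else 0) +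
      (if p001 ∈ S then 1/6 else 0) + (if p111 ∈ S then 1/6 else 0)
  have hw_nonneg : ∀ S, 0 ≤ w S := by
    intro S; simp only [w]; positivity
  have happ : ∀ S : Set (Bool × Bool × Bool), ν S = ENNReal.ofReal (w S) := by
    intro S
    have hS : MeasurableSet S := (Set.toFinite S).measurableSet
    simp only [ν, w, Measure.add_apply, Measure.smul_apply, smul_eq_mul, dirac_apply' _ hS, Set.indicator,
      Pi.one_apply, mul_ite, mul_one, mul_zero]
    have e : ∀ (q : Prop) [Decidable q] (c : ℝ), 0 ≤ c →
        (if q then ENNReal.ofReal c else 0) = ENNReal.ofReal (if q then c else 0) := by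
      intro q _ c _; split_ifs <;> simp
    rw [e _ (1/3) (by norm_num), e _ (1/6) (by norm_num), e _ (1/6) (by norm_num), e _ (1/6) (by norm_num),
      e _ (1/6) (by norm_num), ← ENNReal.ofReal_add, ← ENNReal.ofReal_add, ← ENNReal.ofReal_add, ← ENNReal.ofReal_add]
    all_goals positivity
  have hreal : ∀ S : Set (Bool × Bool × Bool), ν.real S = w S := by
    intro S; rw [measureReal_def, happ, ENNReal.toReal_ofReal (hw_nonneg S)]
  have hprob : IsProbabilityMeasure ν := by
    refine ⟨?_⟩
    rw [happ]
    have : w Set.univ = 1 := by simp only [w, Set.mem_univ, if_true]; norm_num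
    rw [this, ENNReal.ofReal_one]
  have hup : ∀ (P Q : Bool × Bool × Bool → Bool), Monotone P → Monotone Q →
      IsUpperSet {x : Bool × Bool × Bool | P x = true ∨ Q x = true} := by
    intro P Q hP hQ x y hxy hx
    simp only [Set.mem_setOf_eq] at hx ⊢
    rcases hx with h | h
    · left; have := hP hxy; rw [h] at this; revert this; cases P y <;> simp
    · right; have := hQ hxy; rw [h] at this; revert this; cases Q y <;> simp
  have m1 : Monotone (fun x : Bool × Bool × Bool => x.1) := fun x y h => h.1
  have m2 : Monotone (fun x : Bool × Bool × Bool => x.2.1) := fun x y h => h.2.1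
  have m3 : Monotone (fun x : Bool × Bool × Bool => x.2.2) := fun x y h => h.2.2
  refine ⟨ν, hprob, ?_, hup _ _ m1 m2, hup _ _ m1 m3, hup _ _ m2 m3, ?_⟩
  · refine isPositivelyAssociated_of_real fun A B hA hB _ _ => ?_
    rw [hreal, hreal, hreal]
    have hbot : ∀ x : (Bool × Bool × Bool), p000 ≤ x := by decide
    have htop : ∀ x : (Bool × Bool × Bool), x ≤ p111 := by decide
    by_cases hA0 : p000 ∈ A
    · have hAall : ∀ x, x ∈ A := fun x => hA (hbot x) hA0
      have h1 : w A = 1 := by simp only [w, hAall, if_true]; norm_num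
      have h2 : w (A ∩ B) = w B := by simp only [w, Set.mem_inter_iff, hAall, true_and]
      rw [h1, h2, one_mul]
    by_cases hB0 : p000 ∈ B
    · have hBall : ∀ x, x ∈ B := fun x => hB (hbot x) hB0
      have h1 : w B = 1 := by simp only [w, hBall, if_true]; norm_num
      have h2 : w (A ∩ B) = w A := by simp only [w, Set.mem_inter_iff, hBall, and_true]
      rw [h1, h2, mul_one]
    by_cases hA1 : p111 ∈ A
    swap
    · have hAnone : ∀ x, x ∉ A := fun x hx => hA1 (hA (htop x) hx)
      have h1 : w A = 0 := by simp only [w, hAnone, if_false]; norm_num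
      rw [h1, zero_mul]; exact hw_nonneg _
    by_cases hB1 : p111 ∈ B
    swap
    · have hBnone : ∀ x, x ∉ B := fun x hx => hB1 (hB (htop x) hx)
      have h1 : w B = 0 := by simp only [w, hBnone, if_false]; norm_num
      rw [h1, mul_zero]; exact hw_nonneg _
    have hAB0 : p000 ∉ A ∩ B := fun h => hA0 h.1
    have hAB1 : p111 ∈ A ∩ B := ⟨hA1, hB1⟩
    simp only [w, hA0, hB0, hA1, hB1, hAB0, hAB1, if_true, if_false, Set.mem_inter_iff]
    by_cases a1 : p100 ∈ A <;> by_cases a2 : p010 ∈ A <;> by_cases a3 : p001 ∈ A <;>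
      by_cases b1 : p100 ∈ B <;> by_cases b2 : p010 ∈ B <;> by_cases b3 : p001 ∈ B <;>
      simp only [a1, a2, a3, b1, b2, b3, if_true, if_false, and_true, and_self, and_false] <;>
      norm_num
  · simp only [sahiE3, hreal, w, p000, p100, p010, p001, p111, Set.mem_inter_iff, Set.mem_setOf_eq,
      Bool.false_eq_true, or_false, or_self, and_false, and_true, and_self, if_true, if_false, or_true]
    norm_num

end AssociationNoGo

end Summit.CriticalPhenomena.PercolationContinuityZ3.Theorems
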